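import Summits.Ventures.LatticeQCDFlow.Scoring.U1CharacterExpansion
import Summits.Ventures.LatticeQCDFlow.Scoring.OnePlaquetteBessel
import HarnessLib

/-!
# Two-dimensional U(1) with free boundary: every plaquette is an independent one-plaquette variable

HONEST FRAMING: exact (Metropolis-corrected) sampling algorithms for lattice gauge theory;
figures of merit are autocorrelation/cost numbers at stated couplings and volumes; no
continuum-physics claim.

Venture `LatticeQCDFlow` (cell pub-lqcd), sub-topic `Scoring`; FANOUT row 5 (`s0-sun-a`), GEN-7.
NEW WORK of the cell (placement rule).  `Scoring/OnePlaquetteEnclosures.lean` encloses the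
one-plaquette expectation `⟨cos θ⟩_β = I₁(β)/I₀(β)` and says: "in two dimensions the plaquette
variables of an infinite or open lattice are independent one-plaquette variables — a gauge-fixing
fact NOT typed here".  This file types it for U(1), WITHOUT gauge fixing, as a corollary of the
character expansion `Scoring/U1CharacterExpansion.lean`:

* §1 **complexes without closed surfaces.**  If the only integer plaquette assignment with zero net
  charge on every link is `m = 0` (`hfree` — the dual statement of "no closed 2-cycle": true for
  every planar complex with free boundary, false for the torus), then the duality sum has ONE term:
  `u1WilsonZ_eq_prod_of_free` `Z = (2π)^{n+1} ∏_p I₀(β_p)` (the partition function FACTORISES over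
  plaquettes, for arbitrary per-plaquette couplings), a probe character `e^{i s Σ_{p∈A} θ_p}`
  picks `m = −s·𝟙_A` (`setIntegral_cexp_region_mul_weight_of_free`), and the EXACT AREA LAW
  **`u1WilsonExpect_cos_region_of_free`** `⟨cos(Σ_{p ∈ A} θ_p)⟩ = ∏_{p ∈ A} I₁(β_p)/I₀(β_p)` holds
  for every region `A` (`Σ_{p∈A} θ_p` = the holonomy angle of `∂A`); in particular
  **`u1WilsonExpect_cos_plaq_of_free`** `⟨cos θ_{p₀}⟩ = I₁(β_{p₀})/I₀(β_{p₀})`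
  `= onePlaquetteExpect β_{p₀} cos` (`Scoring/OnePlaquetteBessel.lean`) — independent of every
  other coupling and of the size and shape of the lattice;
* §2 **the `L₁ × L₂` grid with free boundary** (plaquettes `Fin L₁ × Fin L₂`; horizontal links
  `Fin L₁ × Fin (L₂+1)`, vertical links `Fin (L₁+1) × Fin L₂`, enumerated by any
  `e : _ ⊕ _ ≃ Fin (n+1)`; `θ_p(a,b) = θ_h(a,b) + θ_v(a+1,b) − θ_h(a,b+1) − θ_v(a,b)`) satisfies
  `hfree` (`openInc_free`: the constraint at the horizontal link `(a, b)` reads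
  `m(a,b) = m(a,b−1)` with `m(a,−1) := 0`, so `m ≡ 0` row by row), hence
  **`open_u1WilsonExpect_cos_plaq`** `⟨cos θ_p⟩ = I₁(β)/I₀(β)` for every `L₁, L₂ ≥ 1`, every
  plaquette and every real `β` — the infinite-volume / open-lattice 2-d U(1) plaquette whose
  twelve-digit enclosures at the reference couplings are `Scoring/OnePlaquetteEnclosures.lean`.

NOT here: SU(N) (the same statement needs the non-abelian character expansion), the lattice
Stokes identity naming `Σ_{p ∈ A} θ_p` as the boundary holonomy, the torus (companion file
`Scoring/U1TorusCharacterFormula.lean`).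
-/

noncomputable section

open scoped Nat
open Real MeasureTheory Set Finset Literature.Analysis.FunctionSpaces

namespace Summit.Ventures.LatticeQCDFlow.Scoring

/-! ### 1. Complexes without closed surfaces -/

section Free

variable {n : ℕ} {ι : Type*} [Fintype ι] [DecidableEq ι] (inc : ι → Fin (n + 1) → ℤ) (βp : ι → ℝ)

/-- **Factorisation of the partition function**: if `m = 0` is the only charge-free integer
plaquette assignment, `Z = (2π)^{n+1} ∏_p I₀(β_p)`. -/
theorem u1WilsonZ_eq_prod_of_free (hfree : ∀ m : ι → ℤ, (∀ l, ∑ p, m p * inc p l = 0) → m = 0) :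
    u1WilsonZ univ inc βp = (2 * π) ^ (n + 1) * ∏ p, besselI 0 (βp p) := by
  rw [u1WilsonZ_univ_eq_tsum, tsum_eq_single (0 : ι → ℤ) fun m hm => if_neg fun h => hm (hfree m h)]
  simp

/-- With a probe character `e^{i s Σ_{p ∈ A} θ_p}` (for a region `A` of plaquettes,
`Σ_{p ∈ A} θ_p` is the holonomy angle of its oriented boundary) the only admissible assignment is
`m = −s·𝟙_A`: `∫ e^{i s Σ_{p∈A} θ_p} W dθ = (2π)^{n+1} ∏_{p ∈ A} I_{|s|}(β_p) ∏_{p ∉ A} I₀(β_p)`. -/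
theorem setIntegral_cexp_region_mul_weight_of_free
    (hfree : ∀ m : ι → ℤ, (∀ l, ∑ p, m p * inc p l = 0) → m = 0) (A : Finset ι) (s : ℤ) :
    ∫ θ in u1TorusBox (n + 1),
        Complex.exp ((s : ℂ) * (∑ p ∈ A, (u1PlaqAngle inc p θ : ℂ)) * Complex.I) *
          ((u1WilsonWeight univ inc βp θ : ℝ) : ℂ) =
      (2 * π : ℂ) ^ (n + 1) *
        ((∏ p ∈ A, (besselI s.natAbs (βp p) : ℂ)) * ∏ p ∈ univ \ A, (besselI 0 (βp p) : ℂ)) := by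
  have hphase : ∀ θ : Fin (n + 1) → ℝ, (s : ℂ) * (∑ p ∈ A, (u1PlaqAngle inc p θ : ℂ)) * Complex.I =
      (∑ l, ((s * ∑ p ∈ A, inc p l : ℤ) : ℂ) * θ l) * Complex.I := fun θ => by
    congr 1
    simp only [u1PlaqAngle]
    push_cast
    simp only [Finset.mul_sum, Finset.sum_mul]
    rw [Finset.sum_comm]
    exact Finset.sum_congr rfl fun p _ => Finset.sum_congr rfl fun l _ => by ring
  simp_rw [hphase]
  have h := setIntegral_cexp_mul_u1WilsonWeight inc βp fun l => s * ∑ p ∈ A, inc p l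
  rw [h]
  congr 1
  -- the admissible assignment
  set m₀ : ι → ℤ := fun p => if p ∈ A then -s else 0 with hm₀
  have hiff : ∀ m : ι → ℤ, (∀ l, s * ∑ p ∈ A, inc p l + ∑ p, m p * inc p l = 0) ↔ m = m₀ := by
    intro m
    have hsplit : ∀ l, s * ∑ p ∈ A, inc p l + ∑ p, m p * inc p l = ∑ p, (m - m₀) p * inc p l := by
      intro l
      simp only [hm₀, Pi.sub_apply, sub_mul, Finset.sum_sub_distrib, ite_mul, zero_mul,
        Finset.sum_ite_mem, Finset.univ_inter, Finset.mul_sum, neg_mul, Finset.sum_neg_distrib]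
      ring
    simp_rw [hsplit]
    constructor
    · intro hl
      exact sub_eq_zero.mp (hfree _ hl)
    · rintro rfl l
      simp
  rw [tsum_eq_single m₀ fun m hm => if_neg fun h => hm ((hiff m).mp h), if_pos ((hiff m₀).mpr rfl),
    ← Finset.prod_sdiff (Finset.subset_univ A), mul_comm]
  congr 1
  · exact Finset.prod_congr rfl fun p hp => by rw [hm₀]; simp only [if_pos hp, Int.natAbs_neg]
  · exact Finset.prod_congr rfl fun p hp => by
      rw [hm₀]; simp only [if_neg (Finset.mem_sdiff.mp hp).2, Int.natAbs_zero]

/-- **Exact area law on a complex without closed surfaces**: for every region `A` of plaquettes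
(couplings arbitrary), `⟨cos(Σ_{p ∈ A} θ_p)⟩ = ∏_{p ∈ A} I₁(β_p)/I₀(β_p)` — the Wilson loop around
`A` factorises into one-plaquette factors (uniform coupling: `(I₁(β)/I₀(β))^{#A}`). -/
theorem u1WilsonExpect_cos_region_of_free
    (hfree : ∀ m : ι → ℤ, (∀ l, ∑ p, m p * inc p l = 0) → m = 0) (A : Finset ι) :
    u1WilsonExpect univ inc βp (fun θ => Real.cos (∑ p ∈ A, u1PlaqAngle inc p θ)) =
      ∏ p ∈ A, besselI 1 (βp p) / besselI 0 (βp p) := by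
  have hW := continuous_u1WilsonWeight univ inc βp
  have hA := fun p => continuous_u1PlaqAngle inc p
  have hI : ∀ s : ℤ, Integrable (fun θ : Fin (n + 1) → ℝ =>
      Complex.exp ((s : ℂ) * (∑ p ∈ A, (u1PlaqAngle inc p θ : ℂ)) * Complex.I) *
        ((u1WilsonWeight univ inc βp θ : ℝ) : ℂ))
      ((volume : Measure (Fin (n + 1) → ℝ)).restrict (u1TorusBox (n + 1))) := fun s =>
    integrableOn_u1TorusBox' (by fun_prop)
  have h1 := setIntegral_cexp_region_mul_weight_of_free inc βp hfree A 1
  have h2 := setIntegral_cexp_region_mul_weight_of_free inc βp hfree A (-1)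
  -- the numerator, complexified
  have hnum : ∫ θ in u1TorusBox (n + 1),
      Real.cos (∑ p ∈ A, u1PlaqAngle inc p θ) * u1WilsonWeight univ inc βp θ =
        (2 * π) ^ (n + 1) * ((∏ p ∈ A, besselI 1 (βp p)) * ∏ p ∈ univ \ A, besselI 0 (βp p)) := by
    apply Complex.ofReal_injective
    rw [← integral_complex_ofReal]
    have hsplit : ∀ θ : Fin (n + 1) → ℝ,
        (((Real.cos (∑ p ∈ A, u1PlaqAngle inc p θ) * u1WilsonWeight univ inc βp θ : ℝ)) : ℂ) =
          (1 / 2 : ℂ) * (Complex.exp (((1 : ℤ) : ℂ) * (∑ p ∈ A, (u1PlaqAngle inc p θ : ℂ)) *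
              Complex.I) * ((u1WilsonWeight univ inc βp θ : ℝ) : ℂ)) +
            (1 / 2 : ℂ) * (Complex.exp (((-1 : ℤ) : ℂ) * (∑ p ∈ A, (u1PlaqAngle inc p θ : ℂ)) *
              Complex.I) * ((u1WilsonWeight univ inc βp θ : ℝ) : ℂ)) := fun θ => by
      push_cast
      rw [Complex.cos]
      ring_nf
    simp_rw [hsplit]
    rw [integral_add ((hI 1).const_mul _) ((hI (-1)).const_mul _), MeasureTheory.integral_const_mul,
      MeasureTheory.integral_const_mul, h1, h2]
    simp only [Int.natAbs_one, Int.natAbs_neg]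
    push_cast
    ring
  have hZ := u1WilsonZ_eq_prod_of_free inc βp hfree
  rw [← Finset.prod_sdiff (Finset.subset_univ A)] at hZ
  have hπ : (2 * π : ℝ) ^ (n + 1) ≠ 0 := by positivity
  have hprod : ∏ p ∈ univ \ A, besselI 0 (βp p) ≠ 0 :=
    Finset.prod_ne_zero_iff.mpr fun p _ => (besselI_zero_pos _).ne'
  rw [u1WilsonExpect, hnum, hZ, mul_div_mul_left _ _ hπ, mul_comm (∏ p ∈ univ \ A, besselI 0 (βp p)),
    mul_div_mul_right _ _ hprod, Finset.prod_div_distrib]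

/-- **Each plaquette is an independent one-plaquette variable**: on a complex without closed
surfaces, `⟨cos θ_{p₀}⟩ = I₁(β_{p₀})/I₀(β_{p₀})`, whatever the other couplings and the size or shape
of the lattice. -/
theorem u1WilsonExpect_cos_plaq_of_free
    (hfree : ∀ m : ι → ℤ, (∀ l, ∑ p, m p * inc p l = 0) → m = 0) (p₀ : ι) :
    u1WilsonExpect univ inc βp (fun θ => Real.cos (u1PlaqAngle inc p₀ θ)) =
      besselI 1 (βp p₀) / besselI 0 (βp p₀) := by
  simpa using u1WilsonExpect_cos_region_of_free inc βp hfree {p₀}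

/-- The same value is the one-plaquette expectation `⟨cos θ⟩_{β_{p₀}}` of
`Scoring/SchwingerDysonOnePlaquette.lean` (enclosed to twelve decimals at the reference couplings in
`Scoring/OnePlaquetteEnclosures.lean`). -/
theorem u1WilsonExpect_cos_plaq_eq_onePlaquetteExpect
    (hfree : ∀ m : ι → ℤ, (∀ l, ∑ p, m p * inc p l = 0) → m = 0) (p₀ : ι) :
    u1WilsonExpect univ inc βp (fun θ => Real.cos (u1PlaqAngle inc p₀ θ)) =
      onePlaquetteExpect (βp p₀) Real.cos := by
  rw [u1WilsonExpect_cos_plaq_of_free inc βp hfree, onePlaquetteExpect_cos_eq_besselI_div]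

end Free

/-! ### 2. The `L₁ × L₂` grid with free boundary -/

section OpenGrid

variable {L₁ L₂ : ℕ} {n : ℕ}
  (e : (Fin L₁ × Fin (L₂ + 1)) ⊕ (Fin (L₁ + 1) × Fin L₂) ≃ Fin (n + 1))

/-- **The plaquette–link incidence of the `L₁ × L₂` grid with free boundary.**  Plaquettes `(a, b)`;
horizontal links `inl (a, j)`, `j = 0 … L₂` (the `j`-th horizontal link of column `a`), vertical
links `inr (i, b)`, `i = 0 … L₁`; the plaquette `(a, b)` runs forwards through its bottom link
`inl (a, b)` and its right link `inr (a+1, b)`, backwards through its top link `inl (a, b+1)` and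
its left link `inr (a, b)`. -/
def openInc (x : Fin L₁ × Fin L₂) (l : Fin (n + 1)) : ℤ :=
  match e.symm l with
  | Sum.inl y => (if y = (x.1, x.2.castSucc) then 1 else 0) - (if y = (x.1, x.2.succ) then 1 else 0)
  | Sum.inr y => (if y = (x.1.succ, x.2) then 1 else 0) - (if y = (x.1.castSucc, x.2) then 1 else 0)

/-- The grid with free boundary has no closed surface: an integer plaquette assignment with zero
net charge on every link vanishes (induction up the columns from the bottom boundary links, which
belong to one plaquette only). -/
theorem openInc_free (m : Fin L₁ × Fin L₂ → ℤ) (hm : ∀ l, ∑ x, m x * openInc e x l = 0) : m = 0 := by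
  -- the constraint at the horizontal link `inl (a, b.castSucc)`: `m (a, b) = Σ_x m x [x.2.succ = b.castSucc ∧ x.1 = a]`
  have key : ∀ (a : Fin L₁) (b : Fin L₂),
      m (a, b) = ∑ x : Fin L₁ × Fin L₂, if (a, b.castSucc) = (x.1, x.2.succ) then m x else 0 := by
    intro a b
    have h := hm (e (Sum.inl (a, b.castSucc)))
    simp only [openInc, Equiv.symm_apply_apply, mul_sub, mul_ite, mul_one, mul_zero,
      Finset.sum_sub_distrib] at h
    have h1 : ∀ x : Fin L₁ × Fin L₂, ((a, b.castSucc) = (x.1, x.2.castSucc)) ↔ x = (a, b) := by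
      intro x
      rw [Prod.mk.injEq, Fin.castSucc_inj]
      constructor
      · rintro ⟨h1, h2⟩; ext <;> simp [h1, h2]
      · rintro rfl; exact ⟨rfl, rfl⟩
    simp_rw [h1] at h
    rw [Finset.sum_ite_eq' univ (a, b) m, if_pos (Finset.mem_univ _)] at h
    linarith
  -- strong induction on the row index
  suffices hrow : ∀ k : ℕ, ∀ b : Fin L₂, b.val = k → ∀ a, m (a, b) = 0 by
    funext x
    exact hrow x.2.val x.2 rfl x.1
  intro k
  induction k using Nat.strong_induction_on with
  | _ k ih =>
    intro b hb a
    rw [key a b]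
    refine Finset.sum_eq_zero fun x _ => ?_
    split_ifs with hx
    · rw [Prod.mk.injEq] at hx
      have hlt : x.2.val < k := by
        have := congrArg Fin.val hx.2
        simp only [Fin.val_castSucc, Fin.val_succ] at this
        omega
      have := ih x.2.val hlt x.2 rfl x.1
      rwa [Prod.mk.eta] at this
    · rfl

/-- **The exact plaquette of the 2-d U(1) lattice with free boundary**: for every `L₁, L₂ ≥ 1`,
every plaquette `x₀` and every real `β`, `⟨cos θ_{x₀}⟩ = I₁(β)/I₀(β)` — the one-plaquette value,
independent of the volume. -/
theorem open_u1WilsonExpect_cos_plaq (β : ℝ) (x₀ : Fin L₁ × Fin L₂) :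
    u1WilsonExpect univ (openInc e) (fun _ => β) (fun θ => Real.cos (u1PlaqAngle (openInc e) x₀ θ)) =
      besselI 1 β / besselI 0 β :=
  u1WilsonExpect_cos_plaq_of_free _ _ (openInc_free e) x₀

/-- … and with arbitrary per-plaquette couplings (defects anywhere) the plaquette at `x₀` still reads
`I₁(β_{x₀})/I₀(β_{x₀}) = onePlaquetteExpect β_{x₀} cos`. -/
theorem open_u1WilsonExpect_cos_plaq_eq_onePlaquetteExpect (βp : Fin L₁ × Fin L₂ → ℝ)
    (x₀ : Fin L₁ × Fin L₂) :
    u1WilsonExpect univ (openInc e) βp (fun θ => Real.cos (u1PlaqAngle (openInc e) x₀ θ)) =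
      onePlaquetteExpect (βp x₀) Real.cos :=
  u1WilsonExpect_cos_plaq_eq_onePlaquetteExpect _ _ (openInc_free e) x₀

/-- **Factorisation**: `Z_{L₁×L₂, free}(β) = (2π)^{n+1} I₀(β)^{L₁L₂}`. -/
theorem open_u1WilsonZ (β : ℝ) :
    u1WilsonZ univ (openInc e) (fun _ => β) = (2 * π) ^ (n + 1) * besselI 0 β ^ (L₁ * L₂) := by
  rw [u1WilsonZ_eq_prod_of_free _ _ (openInc_free e)]
  simp [Finset.prod_const, Finset.card_univ]

end OpenGrid

end Summit.Ventures.LatticeQCDFlow.Scoring
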